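/-
HONEST FRAMING: certified error envelopes and provably optimal rounding/accumulation schemes for
low-precision formats under stated cost models; every table by two implementations; no hardware
or vendor claims.
-/
import Summits.Ventures.CertifiedArithmetic.LowPrec.OptDemotionRoutingThreeFam

/-!
# The demotion law (Theorem T8), part 10k-0: THE NODE RULE FOR AN ARBITRARY CONFIGURATION (injected options)

The multi-family node recursion of opt gen 15 §5b (threefam.py `build`, any number of bits; the
lean seat's fam.py) as theorems for EVERY configuration `{0} ∪ T`, `T ⊆ [1-q, -1]`:
* `split_le_injected` — every valid split of part 8a at a node holding `{0} ∪ T` is dominated by an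
  INJECTED OPTION `({0} ∪ P | (T ∖ P) ∪ {-q})`, `P ⊆ T`, in one of the two orientations (the
  non-injected splits are dominated through (M), part 10g `treeBR_le_of_subset`);
* `injected_le_treeBR_node` — every injected option is realised: `1 + BR_A({0} ∪ P) +
  BR_B((T ∖ P) ∪ {-q}) ≤ BR_{A·B}({0} ∪ T)`;
* `treeBR_node_le_of_injected` — the node value is `1 +` at most any `R ≥ 0` dominating the
  `2^(|T|+1)` injected options.
Parts 10g (`split_three_le`), 10i-0 (`split_pair_le`, `treeBR_triple_node_ge`) and 10h-b
(`treeBR_pair_node_ge`) are the cases `|T| ≤ 2` written out; this file is the tool for the rows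
with three or more offset bits (popcount ≥ 3 e-side rows, two-bit o-side rows).
-/

namespace Summit.Ventures.CertifiedArithmetic.LowPrec.Opt

open Literature.ComputerArithmetic.JeannerodRump2018
open Literature.ComputerArithmetic.JeannerodRump2018.SumTree

section NodeRule

variable {q : ℕ}

/-- A configuration of bits in `[-q, -1]` together with at most the top bit `0`… here: any subset of
`[lo, 0]` with `lo ≥ 1 - q`, or of `[-q, -1]`, is routable. -/
theorem routable_of_bounds {S : Finset ℤ} {lo hi : ℤ} (h : ∀ s ∈ S, lo ≤ s ∧ s ≤ hi)
    (hw : hi ≤ lo + ((q : ℤ) - 1)) : Routable q S := by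
  intro x hx y hy
  have h1 := h x hx; have h2 := h y hy
  omega

/-- **THE NODE RULE, UPPER HALF**: for `T ⊆ [1-q, -1]`, every valid split `(A', B')` of `{0} ∪ T`
at a node is dominated by an injected option `({0} ∪ P | (T ∖ P) ∪ {-q})`, `P ⊆ T`, in one of the
two orientations. -/
theorem split_le_injected (hq : 1 ≤ q) (A B : SumTree) {T : Finset ℤ}
    (hT : ∀ t ∈ T, 1 - (q : ℤ) ≤ t ∧ t ≤ -1) {A' B' : Finset ℤ}
    (h : (A', B') ∈ splits q (insert 0 T) 0) :
    ∃ P, P ⊆ T ∧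
      (treeBR q A A' + treeBR q B B' ≤ treeBR q A (insert 0 P) + treeBR q B (insert (-(q : ℤ)) (T \ P)) ∨
        treeBR q A A' + treeBR q B B' ≤ treeBR q B (insert 0 P) + treeBR q A (insert (-(q : ℤ)) (T \ P))) := by
  classical
  -- the one-orientation statement
  have key : ∀ (X Y : SumTree) (X' Y' : Finset ℤ), (X', Y') ∈ splits q (insert 0 T) 0 → (0 : ℤ) ∈ X' →
      ∃ P, P ⊆ T ∧ treeBR q X X' + treeBR q Y Y' ≤ treeBR q X (insert 0 P) + treeBR q Y (insert (-(q : ℤ)) (T \ P)) := by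
    intro X Y X' Y' hXY h0
    obtain ⟨hA, hB, hdisj, -, hrA, -⟩ := of_mem_splits (A := X') (B := Y') hXY
    rw [zero_sub] at hA hB
    have hιA : -(q : ℤ) ∉ X' := fun hι => not_routable_of_mem_mem hrA h0 (by rwa [zero_sub])
    refine ⟨X'.erase 0, ?_, ?_⟩
    · intro z hz
      obtain ⟨hz0, hzX⟩ := Finset.mem_erase.1 hz
      have := hA hzX
      rcases Finset.mem_insert.1 this with h1 | h1
      · exact absurd (h1 ▸ hzX) hιA
      · rcases Finset.mem_insert.1 h1 with h2 | h2
        · exact absurd h2 hz0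
        · exact h2
    · rw [Finset.insert_erase h0]
      refine add_le_add le_rfl (treeBR_le_of_subset hq Y ?_ ?_)
      · intro z hz
        have hzX : z ∉ X' := fun hzX => Finset.disjoint_left.1 hdisj hzX hz
        have := hB hz
        rcases Finset.mem_insert.1 this with h1 | h1
        · rw [h1]; exact Finset.mem_insert_self _ _
        · rcases Finset.mem_insert.1 h1 with h2 | h2
          · exact absurd (h2 ▸ h0) (h2 ▸ hzX)
          · exact Finset.mem_insert_of_mem (Finset.mem_sdiff.2 ⟨h2, fun h3 => hzX (Finset.mem_of_mem_erase h3)⟩)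
      · have hb : ∀ s ∈ insert (-(q : ℤ)) (T \ X'.erase 0), -(q : ℤ) ≤ s ∧ s ≤ -1 := by
          intro s hs
          rcases Finset.mem_insert.1 hs with h1 | h1
          · omega
          · have := hT s (Finset.mem_sdiff.1 h1).1; omega
        have hw : (-1 : ℤ) ≤ -(q : ℤ) + ((q : ℤ) - 1) := by omega
        exact routable_of_bounds hb hw
  by_cases h0 : (0 : ℤ) ∈ A'
  · obtain ⟨P, hP, hle⟩ := key A B A' B' h h0
    exact ⟨P, hP, Or.inl hle⟩
  · obtain ⟨-, -, -, hcov, -, -⟩ := of_mem_splits (A := A') (B := B') h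
    have h0B : (0 : ℤ) ∈ B' := by
      have := hcov (Finset.mem_insert_self (0 : ℤ) T)
      rcases Finset.mem_union.1 this with h' | h'
      · exact absurd h' h0
      · exact h'
    obtain ⟨P, hP, hle⟩ := key B A B' A' (swap_mem_splits h) h0B
    refine ⟨P, hP, Or.inr ?_⟩
    rw [add_comm]; exact hle

/-- **THE NODE RULE, LOWER HALF**: every injected option is a valid split, so
`1 + BR_A({0} ∪ P) + BR_B((T ∖ P) ∪ {-q}) ≤ BR_{A·B}({0} ∪ T)` for `P ⊆ T ⊆ [1-q, -1]`. -/
theorem injected_le_treeBR_node (hq : 1 ≤ q) (A B : SumTree) {T : Finset ℤ}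
    (hT : ∀ t ∈ T, 1 - (q : ℤ) ≤ t ∧ t ≤ -1) {P : Finset ℤ} (hP : P ⊆ T) :
    1 + (treeBR q A (insert 0 P) + treeBR q B (insert (-(q : ℤ)) (T \ P))) ≤
      treeBR q (.node A B) (insert 0 T) := by
  classical
  set S : Finset ℤ := insert 0 T with hSdef
  have hne : S.Nonempty := Finset.insert_nonempty _ _
  have hmax : S.max' hne = 0 := by
    refine le_antisymm (Finset.max'_le _ hne _ fun z hz => ?_) (Finset.le_max' _ _ (by simp [hSdef]))
    rcases Finset.mem_insert.1 hz with h | h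
    · omega
    · have := hT z h; omega
  have h0T : (0 : ℤ) ∉ T := fun h => by have := hT 0 h; omega
  have hqT : -(q : ℤ) ∉ T := fun h => by have := hT _ h; omega
  have hqP : -(q : ℤ) ∉ P := fun h => hqT (hP h)
  have hAsub : insert 0 P ⊆ insert ((0 : ℤ) - q) S := by
    intro z hz
    rcases Finset.mem_insert.1 hz with h | h
    · rw [h, hSdef]; exact Finset.mem_insert_of_mem (Finset.mem_insert_self _ _)
    · rw [hSdef]; exact Finset.mem_insert_of_mem (Finset.mem_insert_of_mem (hP h))
  have hBeq : insert ((0 : ℤ) - q) S \ insert 0 P = insert (-(q : ℤ)) (T \ P) := by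
    ext z
    simp only [hSdef, zero_sub, Finset.mem_sdiff, Finset.mem_insert]
    constructor
    · rintro ⟨h1 | h1 | h1, h2⟩
      · exact Or.inl h1
      · exact absurd (Or.inl h1) h2
      · exact Or.inr ⟨h1, fun h3 => h2 (Or.inr h3)⟩
    · rintro (h1 | ⟨h1, h2⟩)
      · refine ⟨Or.inl h1, ?_⟩
        rintro (h3 | h3)
        · have hqz : (1 : ℤ) ≤ q := by exact_mod_cast hq
          omega
        · exact hqP (h1 ▸ h3)
      · refine ⟨Or.inr (Or.inr h1), ?_⟩
        rintro (h3 | h3)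
        · exact h0T (h3 ▸ h1)
        · exact h2 h3
  have hrA : Routable q (insert 0 P) := by
    have hb : ∀ s ∈ insert (0 : ℤ) P, 1 - (q : ℤ) ≤ s ∧ s ≤ 0 := by
      intro s hs
      rcases Finset.mem_insert.1 hs with h | h
      · omega
      · have := hT s (hP h); omega
    have hw : (0 : ℤ) ≤ 1 - (q : ℤ) + ((q : ℤ) - 1) := by omega
    exact routable_of_bounds hb hw
  have hrB : Routable q (insert (-(q : ℤ)) (T \ P)) := by
    have hb : ∀ s ∈ insert (-(q : ℤ)) (T \ P), -(q : ℤ) ≤ s ∧ s ≤ -1 := by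
      intro s hs
      rcases Finset.mem_insert.1 hs with h | h
      · omega
      · have := hT s (Finset.mem_sdiff.1 h).1; omega
    have hw : (-1 : ℤ) ≤ -(q : ℤ) + ((q : ℤ) - 1) := by omega
    exact routable_of_bounds hb hw
  have hm : (insert 0 P, insert (-(q : ℤ)) (T \ P)) ∈ splits q S (S.max' hne) := by
    rw [hmax]
    refine mem_splits.2 ⟨Or.inr ⟨hAsub, ?_⟩, hrA, hrB⟩
    exact hBeq.symm
  have := split_le_treeBRw_node (q := q) (W := fun e => (2 : ℚ) ^ e) (a := A) (b := B) hne hm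
  rw [hmax, zpow_zero] at this
  exact this

/-- **THE NODE RULE**: the value of `{0} ∪ T` (`T ⊆ [1-q, -1]`) at a node is `1 +` at most any
`R ≥ 0` dominating every injected option in both orientations. -/
theorem treeBR_node_le_of_injected (hq : 1 ≤ q) (A B : SumTree) {T : Finset ℤ}
    (hT : ∀ t ∈ T, 1 - (q : ℤ) ≤ t ∧ t ≤ -1) {R : ℚ} (hR : 0 ≤ R)
    (hall : ∀ P, P ⊆ T →
      treeBR q A (insert 0 P) + treeBR q B (insert (-(q : ℤ)) (T \ P)) ≤ R ∧
        treeBR q B (insert 0 P) + treeBR q A (insert (-(q : ℤ)) (T \ P)) ≤ R) :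
    treeBR q (.node A B) (insert 0 T) ≤ 1 + R := by
  have hne : (insert 0 T : Finset ℤ).Nonempty := Finset.insert_nonempty _ _
  have hmax : (insert 0 T : Finset ℤ).max' hne = 0 := by
    refine le_antisymm (Finset.max'_le _ hne _ fun z hz => ?_) (Finset.le_max' _ _ (by simp))
    rcases Finset.mem_insert.1 hz with h | h
    · omega
    · have := hT z h; omega
  have h := treeBRw_node_le (q := q) (W := fun e => (2 : ℚ) ^ e) (a := A) (b := B) hne hR
    (fun AB hAB => by
      rw [hmax] at hAB
      obtain ⟨P, hP, hle⟩ := split_le_injected hq A B hT (A' := AB.1) (B' := AB.2) hAB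
      obtain ⟨h1, h2⟩ := hall P hP
      unfold treeBR at hle h1 h2
      rcases hle with hle | hle
      · exact le_trans hle h1
      · exact le_trans hle h2)
  rw [hmax, zpow_zero] at h
  exact h

end NodeRule

end Summit.Ventures.CertifiedArithmetic.LowPrec.Opt
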